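import Summits.QuantumFields.YangMills.Theorems.IR.AfPincerUcXCovFemtoTemperedSharp
import HarnessLib

/-!
# Crux `IR` (stmt-QuantumFields-19354), line `af-pincer`, X-side: the R105-COMPACT KIT, I —
# `LowerBoundsCpt` (the NT floors with a COMPACTLY SUPPORTED two-point witness), the compat lemma, the compact-witness
# twins `IRCpt` ∕ `OnsetSharpUKPcSCCpt` ∕ `IRNSCCpt`, and lane (1)A WITHOUT ENVELOPE ⇒ I♯_SC-cpt ⇒ `IRCpt` BY NAME

Seat ym-19354-afpincer-s2 (generation 4; X-desk of lane (1)A, slot «sharp merge I♯_SC» 28967a1bf60ad397).  Helper module for item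
`stmt-QuantumFields-19354` (`--supports stmt-QuantumFields-19354 --as helper`; it closes nothing).

WHY.  Owner ruling R105 (ym-beyond-p2 g29, 2026-08-27T13:0xZ) adopted S2's located reading (R) as ROUTE-TEXT CANDIDATE «R105-compact»:
«type `LowerBounds`(i) with a COMPACTLY SUPPORTED witness (bump, as `Statement.stub_lower` delivers)» — then lane (1)A owes EXACTLY the
asymptotic-freedom WINDOW `SharpLanes.CovWindowAt` (a UV-desk statement) and NO crossover envelope `SharpLanes.CovEnvelopeAt` (which beyond
`‖x−y‖ ≳ ℓ log ℓ` is translation-uniform clustering, IR-flavoured, owed by nobody).  R105 names the price of the edit: it touches the NT∕IR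
interface constant `DlrCollarTransfer.LowerBounds` shared by two binders, so it needs (a) NT-desk concurrence «the floors' witness is a bump BY
DECL NAME» and (b) a compat lemma `LowerBounds_compact → LowerBounds`.  This file and its sequel `…CompactWitnessProducers` make the candidate
DECIDABLE IN THE KERNEL: every registered producer of `LowerBounds` (crux `NT` v4T `stub_refpkgT`, crux `UVSeamRec` v4-F
`stub_ceilings ⊕ stub_floorsEngine`, the femto package `FBL ∧ FC2 ∧ FC3`) already delivers the compact form, every consumer (`ROT`,
`UVOtherGroups`, the Y2 bridge) accepts it through (b), and the compact twin `IRCpt` of the crux is closed by lane (1)A from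
format-at-scale + WINDOW alone (this file, §3) — so the route still assembles (`closes_cpt`, sequel §5).

* §1 `LowerBoundsCpt G r a` — `DlrCollarTransfer.LowerBounds G r a` with `HasCompactSupport v` added to clause (i) (clause (ii) verbatim);
  `lowerBounds_of_lowerBoundsCpt` (R105 (b)); `compactWitness_of_lowerBoundsCpt` (the `hlbc` shape of generation 2∕3's
  `…_of_compactWitness` lemmas).
* §2 the compact-witness twins of the crux-side currencies: `IRCpt` (text of `Theses.BalabanLadder.IR` with `LowerBoundsCpt`), `IRNSCCpt`
  (residual), `OnsetSharpUKPcSCCpt` (I♯_SC); MONOTONICITY `irCpt_of_ir`, `irNSCCpt_of_irNSC`, `onsetSharpUKPcSCCpt_of_onsetSharpUKPcSC`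
  (the twins are WEAKER than the registered texts — fewer witnesses to serve); and the cone exit with E discharged by name:
  `irCpt_of_onsetSharpSCCpt : OnsetSharpUKPcSCCpt → IRNSCCpt → IRCpt` (mirror of `SharpOnset.irCal_of_sharpUcSC`, `AfPincerUc.stub_typCriterionUc`).
* §3 lane (1)A WITHOUT ENVELOPE: `LaneAWindowContractSC` (= `SharpLanes.LaneAContractSC` minus `CovEnvelopeAt`: per simply connected `(G, r)`
  one admissible `(n, ε)` and ONE scale `ℓ` with `TypFormatAtScaleAt r.ρ n ε ℓ ∧ CovWindowAt G r ℓ`); `laneAWindowContractSC_of_laneAContractSC`;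
  the pin and the I♯ clause at `(G, r, a)` for a compact witness at a general scale `ℓ` (`mul_scale_lt_of_covWindow_cpt`,
  `onsetSharp_clause_of_laneA_cpt`; generation 2's `afBelowScale_clause_of_covarianceAF_of_compact` + `scale_pinned_of_witness`);
  **`onsetSharpUKPcSCCpt_of_laneAWindowContractSC`**, **`irCpt_of_laneAWindowContractSC`**; and the femto instances
  (`LaneAFemtoWindowContractSC`: format at `1/u` + the TEMPERED femto package in unit `u`, no envelope; implied by generation 3's
  `LaneATemperedContractSC` ∕ `LaneAFemtoContractSC`; implies `LaneAWindowContractSC`).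

HONEST FRAMING.  Definitions and kernel compositions among OPEN statements; the WINDOW, the format and the floors are typed asks; nothing of
asymptotic freedom, weak-coupling mixing or a gap is proved; `IRCpt` is a CANDIDATE re-cut text (owner's call), weaker than the registered `IR`;
one open gap-crux of a CONDITIONAL chain (Track A 0/28 UV); not Clay.  No `sorry`; axioms ⊆ {propext, Classical.choice, Quot.sound}.
-/

set_option autoImplicit false

noncomputable section

open Filter Topology MeasureTheory
open scoped SchwartzMap
open Literature.MathematicalPhysics.QuantumFieldTheory hiding ZdEdge
open Literature.MathematicalPhysics.QuantumLattice
open Literature.Probability.LatticeModels (Site box mem_box)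
open Summit.QuantumFields.YangMills.Cruxes.OSLegsFromFemtoAndGap.DlrCollarTransfer

namespace Summit.QuantumFields.YangMills.Cruxes.IR.AfPincerUc.Compact

open Summit.QuantumFields.YangMills.Cruxes.IR.AfPincerUc
open Summit.QuantumFields.YangMills.Cruxes.IR.AfPincerUc.SharpLanes

/-! ## §1 `LowerBoundsCpt`: the NT floors with a compactly supported two-point witness, and the compat lemma -/
section Defs

variable (G : Type) [Group G] [TopologicalSpace G] [IsTopologicalGroup G] [CompactSpace G]
  [MeasurableSpace G] [BorelSpace G] (r : LatticeRep G) (a : ℝ → ℝ)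

/-- **`LowerBoundsCpt G r a` — the non-triviality floors with a COMPACTLY SUPPORTED two-point witness (owner's R105-compact text candidate).**
Clause (i): one real positive-time Schwartz function `v` WITH COMPACT SUPPORT and `ε > 0`, `β₅`, `Λ₅` with `ε ≤ Q2_{β,L,a(β)}(θv, v)` for all
`β ≥ β₅` and all tori `2L+1` with `a(β)·L ≥ Λ₅`; clause (ii): VERBATIM clause (ii) of `DlrCollarTransfer.LowerBounds G r a` (three real
Schwartz functions with pairwise disjoint supports and `ε ≤ |Q3(f, g, h)|` likewise).  I.e. `LowerBounds G r a` with the single conjunct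
`HasCompactSupport v` added in clause (i) — the shape in which every registered producer states its floors (crux `UVSeamRec` v4-F
`stub_floorsEngine`; `UVSeamRec.FloorsC`; the NT reference packages' `tsupport v ⊆ closedBall 0 σ`). -/
def LowerBoundsCpt : Prop :=
  (∃ (v : 𝓢(EuclideanSpace ℝ (Fin 4), ℝ)) (ε β₅ Λ₅ : ℝ),
      HasCompactSupport (v : EuclideanSpace ℝ (Fin 4) → ℝ) ∧
      tsupport v ⊆ {y : EuclideanSpace ℝ (Fin 4) | 0 < y 0} ∧ 0 < ε ∧
      ∀ β : ℝ, β₅ ≤ β → ∀ L : ℕ, Λ₅ ≤ a β * L → ε ≤ Q2 G r β L (a β) (thetaTest 4 v) v) ∧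
  (∃ (f g h : 𝓢(EuclideanSpace ℝ (Fin 4), ℝ)) (ε β₅ Λ₅ : ℝ),
      Disjoint (tsupport f) (tsupport g) ∧ Disjoint (tsupport g) (tsupport h) ∧ Disjoint (tsupport f) (tsupport h) ∧
      0 < ε ∧ ∀ β : ℝ, β₅ ≤ β → ∀ L : ℕ, Λ₅ ≤ a β * L → ε ≤ |Q3 G r β L (a β) f g h|)

variable {G r a}

/-- **R105 (b), the compat lemma: `LowerBoundsCpt → LowerBounds`** (forget the compact support; same witnesses and constants). [bookkeeping] -/
theorem lowerBounds_of_lowerBoundsCpt (h : LowerBoundsCpt G r a) : LowerBounds G r a := by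
  obtain ⟨⟨v, ε, β₅, Λ₅, -, hv, hε, hfl⟩, h3⟩ := h
  exact ⟨⟨v, ε, β₅, Λ₅, hv, hε, hfl⟩, h3⟩

/-- Clause (i) of `LowerBoundsCpt` in the argument order of generation 2∕3's `…_of_compactWitness` lemmas
(`tsupport ⊆ …` before `HasCompactSupport`). [bookkeeping] -/
theorem compactWitness_of_lowerBoundsCpt (h : LowerBoundsCpt G r a) :
    ∃ (v : 𝓢(EuclideanSpace ℝ (Fin 4), ℝ)) (ε₅ β₅ Λ₅ : ℝ),
      tsupport v ⊆ {y : EuclideanSpace ℝ (Fin 4) | 0 < y 0} ∧ HasCompactSupport v ∧ 0 < ε₅ ∧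
        ∀ β : ℝ, β₅ ≤ β → ∀ L : ℕ, Λ₅ ≤ a β * L → ε₅ ≤ Q2 G r β L (a β) (thetaTest 4 v) v := by
  obtain ⟨⟨v, ε, β₅, Λ₅, hvc, hv, hε, hfl⟩, -⟩ := h
  exact ⟨v, ε, β₅, Λ₅, hv, hvc, hε, hfl⟩

/-- `LowerBoundsCpt` assembled from a compact-witness clause (i) (seam order) and a plain clause (ii). [bookkeeping] -/
theorem lowerBoundsCpt_of_clauses
    (h2 : ∃ (v : 𝓢(EuclideanSpace ℝ (Fin 4), ℝ)) (ε β₅ Λ₅ : ℝ),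
      HasCompactSupport (v : EuclideanSpace ℝ (Fin 4) → ℝ) ∧
      tsupport v ⊆ {y : EuclideanSpace ℝ (Fin 4) | 0 < y 0} ∧ 0 < ε ∧
      ∀ β : ℝ, β₅ ≤ β → ∀ L : ℕ, Λ₅ ≤ a β * L → ε ≤ Q2 G r β L (a β) (thetaTest 4 v) v)
    (h3 : ∃ (f g h : 𝓢(EuclideanSpace ℝ (Fin 4), ℝ)) (ε β₅ Λ₅ : ℝ),
      Disjoint (tsupport f) (tsupport g) ∧ Disjoint (tsupport g) (tsupport h) ∧ Disjoint (tsupport f) (tsupport h) ∧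
      0 < ε ∧ ∀ β : ℝ, β₅ ≤ β → ∀ L : ℕ, Λ₅ ≤ a β * L → ε ≤ |Q3 G r β L (a β) f g h|) :
    LowerBoundsCpt G r a :=
  ⟨h2, h3⟩

/-- `LowerBoundsCpt` from compact-witness clause (i) and the plain floors (clause (ii) taken from `LowerBounds`). [bookkeeping] -/
theorem lowerBoundsCpt_of_lowerBounds_of_compactWitness (h : LowerBounds G r a)
    (h2 : ∃ (v : 𝓢(EuclideanSpace ℝ (Fin 4), ℝ)) (ε β₅ Λ₅ : ℝ),
      HasCompactSupport (v : EuclideanSpace ℝ (Fin 4) → ℝ) ∧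
      tsupport v ⊆ {y : EuclideanSpace ℝ (Fin 4) | 0 < y 0} ∧ 0 < ε ∧
      ∀ β : ℝ, β₅ ≤ β → ∀ L : ℕ, Λ₅ ≤ a β * L → ε ≤ Q2 G r β L (a β) (thetaTest 4 v) v) :
    LowerBoundsCpt G r a :=
  ⟨h2, h.2⟩

end Defs

/-! ## §2 The compact-witness twins of the crux-side currencies, their monotonicity, and the cone exit with E by name -/

/-- **`IRCpt` — the text of `Theses.BalabanLadder.IR` with `LowerBoundsCpt` in place of `LowerBounds`** (R105-compact candidate text for crux
`IR`, stmt-QuantumFields-19354): for every compact simple `G`, every `r`, every positive unit map `a → 0`, compact-witness floors in units `a`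
imply the volume-uniform lattice gap in units `a`.  WEAKER than the registered `IR` (`irCpt_of_ir`). -/
def IRCpt : Prop :=
  ∀ (G : Type) [Group G] [TopologicalSpace G] [IsTopologicalGroup G] [CompactSpace G],
    IsCompactSimpleLieGroup G → letI : MeasurableSpace G := borel G; haveI : BorelSpace G := ⟨rfl⟩;
    ∀ (r : LatticeRep G) (a : ℝ → ℝ), (∀ β, 0 < a β) → Tendsto a atTop (𝓝 0) →
      LowerBoundsCpt G r a → GapInUnits G r a

/-- **`IRNSCCpt` — the residual `SharpOnset.IRNSC` (registered `stub_irNSC` type) with `LowerBoundsCpt`** (non-simply-connected family). -/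
def IRNSCCpt : Prop :=
  ∀ (G : Type) [Group G] [TopologicalSpace G] [IsTopologicalGroup G] [CompactSpace G],
    IsCompactSimpleLieGroup G → ¬ SimplyConnectedSpace G →
    letI : MeasurableSpace G := borel G; haveI : BorelSpace G := ⟨rfl⟩;
    ∀ (r : LatticeRep G) (a : ℝ → ℝ), (∀ β, 0 < a β) → Tendsto a atTop (𝓝 0) →
      LowerBoundsCpt G r a → GapInUnits G r a

/-- **`OnsetSharpUKPcSCCpt` — I♯_SC (`SharpOnset.OnsetSharpUKPcSC`, registered `stub_onsetSharpSC` type) with `LowerBoundsCpt`**: on the simply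
connected family, for every `(G, r)` and positive unit `a → 0` carrying COMPACT-witness floors, some admissible `(n, ε)` such that for every
budget `δ > 0` the typical format holds for all large `β` at some mesh `b ≥ 1` with `a β · b < T`. -/
def OnsetSharpUKPcSCCpt : Prop :=
  ∀ (G : Type) [Group G] [TopologicalSpace G] [IsTopologicalGroup G] [CompactSpace G],
    IsCompactSimpleLieGroup G → SimplyConnectedSpace G →
    letI : MeasurableSpace G := borel G; haveI : BorelSpace G := ⟨rfl⟩;
    ∀ (r : LatticeRep G) (a : ℝ → ℝ), (∀ β, 0 < a β) → Tendsto a atTop (𝓝 0) → LowerBoundsCpt G r a →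
      ∃ (n : ℕ) (ε : ℝ), 1 ≤ n ∧ 0 ≤ ε ∧ ε * OnsetFormats.shellCount n ≤ 3 / 4 ∧
        ∀ δ : ℝ, 0 < δ → ∃ T β₂ : ℝ, ∀ β : ℝ, β₂ ≤ β →
          ∃ b : ℕ, 1 ≤ b ∧ a β * (b : ℝ) < T ∧ TypShellCondUKPc r.ρ β b n ε δ

/-- **Monotonicity: the registered crux text implies its compact twin** (`IR → IRCpt`; compat lemma). [bookkeeping] -/
theorem irCpt_of_ir (h : Summit.QuantumFields.YangMills.Theses.BalabanLadder.IR) : IRCpt := by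
  intro G _ _ _ _ hG
  letI : MeasurableSpace G := borel G
  haveI : BorelSpace G := ⟨rfl⟩
  intro r a ha hat hlbc
  exact h G hG r a ha hat (lowerBounds_of_lowerBoundsCpt hlbc)

/-- **Monotonicity: the registered residual implies its compact twin** (`IRNSC → IRNSCCpt`). [bookkeeping] -/
theorem irNSCCpt_of_irNSC (h : SharpOnset.IRNSC) : IRNSCCpt := by
  intro G _ _ _ _ hG hsc
  letI : MeasurableSpace G := borel G
  haveI : BorelSpace G := ⟨rfl⟩
  intro r a ha hat hlbc
  exact h G hG hsc r a ha hat (lowerBounds_of_lowerBoundsCpt hlbc)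

/-- `IRCpt` restricted to the non-simply-connected family is `IRNSCCpt`. [bookkeeping] -/
theorem irNSCCpt_of_irCpt (h : IRCpt) : IRNSCCpt := by
  intro G _ _ _ _ hG _
  exact h G hG

/-- **Monotonicity: I♯_SC implies its compact twin** (`OnsetSharpUKPcSC → OnsetSharpUKPcSCCpt`). [bookkeeping] -/
theorem onsetSharpUKPcSCCpt_of_onsetSharpUKPcSC (h : SharpOnset.OnsetSharpUKPcSC) : OnsetSharpUKPcSCCpt := by
  intro G _ _ _ _ hG hsc
  letI : MeasurableSpace G := borel G
  haveI : BorelSpace G := ⟨rfl⟩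
  intro r a ha hat hlbc
  exact h G hG hsc r a ha hat (lowerBounds_of_lowerBoundsCpt hlbc)

/-- **The cone exit in compact currency: E ∧ I♯_SC-cpt ∧ R_NSC-cpt ⇒ `IRCpt` (PROVED; E discharged BY NAME `AfPincerUc.stub_typCriterionUc`,
p524017).**  Mirror of `SharpOnset.irCal_of_sharpUcSC`: the floors enter only through the supplier's pin `a β · b < T`, so the witness class is
immaterial to the seam `gapInUnits_of_fmtOnset`. [kernel composition; I♯_SC-cpt and the residual are OPEN] -/
theorem irCpt_of_onsetSharpSCCpt (hS : OnsetSharpUKPcSCCpt) (hN : IRNSCCpt) : IRCpt := by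
  intro G _ _ _ _ hG
  letI : MeasurableSpace G := borel G
  haveI : BorelSpace G := ⟨rfl⟩
  intro r a ha hat hlbc
  by_cases hsc : SimplyConnectedSpace G
  · obtain ⟨n, ε, hn, hε, hM, h⟩ := hS G hG hsc r a ha hat hlbc
    obtain ⟨δ₀, κ, s₀, hδ₀, hκ, hcl⟩ := fmtClustering_of_typCriterionUKPc stub_typCriterionUc r hn hε hM
    obtain ⟨T, β₂, hb⟩ := h δ₀ hδ₀
    refine gapInUnits_of_fmtOnset r a ha hκ hcl (β₂ := β₂) (T := T) (β₆ := β₂) ?_ ?_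
    · intro β hβ
      obtain ⟨b, hb1, -, hP⟩ := hb β hβ
      exact ⟨b, hb1, hP⟩
    · intro β hβ
      obtain ⟨b, hb1, hlt, hP⟩ := hb β hβ
      have hle : fmtOnset (fun β' b => TypShellCondUKPc r.ρ β' b n ε δ₀) β ≤ b :=
        fmtOnset_le (fun β' b => TypShellCondUKPc r.ρ β' b n ε δ₀) β hb1 hP
      have hle' : (fmtOnset (fun β' b => TypShellCondUKPc r.ρ β' b n ε δ₀) β : ℝ) ≤ (b : ℝ) := by
        exact_mod_cast hle
      calc a β * (fmtOnset (fun β' b => TypShellCondUKPc r.ρ β' b n ε δ₀) β : ℝ) ≤ a β * (b : ℝ) :=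
            mul_le_mul_of_nonneg_left hle' (ha β).le
        _ < T := hlt
  · exact hN G hG hsc r a ha hat hlbc

/-! ## §3 Lane (1)A WITHOUT ENVELOPE ⇒ I♯_SC-cpt ⇒ `IRCpt` -/

/-- **Lane (1)A contract WITHOUT ENVELOPE (SC family)** — `SharpLanes.LaneAContractSC` with `CovEnvelopeAt` dropped: for every simply connected
compact simple `G` and every lattice representation `r`, ONE admissible `(n, ε)` and ONE scale `ℓ` carrying the I-side format-at-scale
`TypFormatAtScaleAt r.ρ n ε ℓ` and the asymptotic-freedom WINDOW `CovWindowAt G r ℓ` (the UV-desk ask, leg-1 node candidate «N29»).  Under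
R105-compact this is the whole lane (1)A contract (`irCpt_of_laneAWindowContractSC`). -/
def LaneAWindowContractSC : Prop :=
  ∀ (G : Type) [Group G] [TopologicalSpace G] [IsTopologicalGroup G] [CompactSpace G],
    IsCompactSimpleLieGroup G → SimplyConnectedSpace G →
    letI : MeasurableSpace G := borel G; haveI : BorelSpace G := ⟨rfl⟩;
    ∀ r : LatticeRep G, ∃ (n : ℕ) (ε : ℝ), 1 ≤ n ∧ 0 ≤ ε ∧ ε * OnsetFormats.shellCount n ≤ 3 / 4 ∧
      ∃ ℓ : ℝ → ℝ, TypFormatAtScaleAt r.ρ n ε ℓ ∧ CovWindowAt G r ℓ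

/-- The LEAD's lane (1)A contract (with envelope) implies the envelope-free contract (drop the envelope). [bookkeeping] -/
theorem laneAWindowContractSC_of_laneAContractSC (h : LaneAContractSC) : LaneAWindowContractSC := by
  intro G _ _ _ _ hG hsc
  letI : MeasurableSpace G := borel G
  haveI : BorelSpace G := ⟨rfl⟩
  intro r
  obtain ⟨n, ε, hn, hε, hM, ℓ, hF, -, haf⟩ := h G hG hsc r
  exact ⟨n, ε, hn, hε, hM, ℓ, hF, haf⟩

section Pointwise

variable {G : Type} [Group G] [TopologicalSpace G] [IsTopologicalGroup G] [CompactSpace G]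
  [MeasurableSpace G] [BorelSpace G]

/-- **THE PIN WITHOUT ENVELOPE at a general scale (PROVED):** WINDOW at `ℓ` and compact-witness floors at unit `a` give `T₀, β₁` with
`a(β)·ℓ(β) < T₀` for `β ≥ β₁` (generation 2's `afBelowScale_clause_of_covarianceAF_of_compact` + `scale_pinned_of_witness`; compare
`SharpLanes.mul_scale_lt_of_covWindow`, which pays `CovEnvelopeAt` for a general Schwartz witness). [kernel composition; the WINDOW is OPEN] -/
theorem mul_scale_lt_of_covWindow_cpt (r : LatticeRep G) (a ℓ : ℝ → ℝ) (ha : ∀ β, 0 < a β)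
    (haf : CovWindowAt G r ℓ) (hlbc : LowerBoundsCpt G r a) :
    ∃ T₀ β₁ : ℝ, ∀ β : ℝ, β₁ ≤ β → a β * ℓ β < T₀ := by
  obtain ⟨v, ε₅, β₅, Λ₅, hv, hvc, hε₅, hlow⟩ := compactWitness_of_lowerBoundsCpt hlbc
  obtain ⟨T, β₁, hT⟩ := afBelowScale_clause_of_covarianceAF_of_compact r ℓ haf v hv hvc (half_pos hε₅)
  exact ⟨T, max β₁ β₅, scale_pinned_of_witness r a ℓ ha hlow hT hε₅⟩

/-- Corollary of the envelope-free pin: WINDOW(ℓ) + compact-witness floors at `a` transport format-at-scale `ℓ` to format-at-scale `1/a`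
(`SharpLanes.typFormatAtScaleAt_mono` with `ℓ ≤ max T₀ 1 · (1/a)` eventually). [kernel composition] -/
theorem typFormatAtScaleAt_inv_of_covWindow_cpt (r : LatticeRep G) (a ℓ : ℝ → ℝ) (ha : ∀ β, 0 < a β)
    (haf : CovWindowAt G r ℓ) (hlbc : LowerBoundsCpt G r a) {n : ℕ} {ε : ℝ}
    (hF : TypFormatAtScaleAt r.ρ n ε ℓ) : TypFormatAtScaleAt r.ρ n ε (fun β => 1 / a β) := by
  obtain ⟨T₀, β₁, hT⟩ := mul_scale_lt_of_covWindow_cpt r a ℓ ha haf hlbc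
  refine typFormatAtScaleAt_mono hF (lt_max_of_lt_right one_pos : (0 : ℝ) < max T₀ 1) ⟨β₁, fun β hβ => ?_⟩
  have h1 := hT β hβ
  have ha' := ha β
  rw [mul_one_div, le_div_iff₀ ha']
  calc ℓ β * a β = a β * ℓ β := mul_comm _ _
    _ ≤ T₀ := h1.le
    _ ≤ max T₀ 1 := le_max_left _ _

/-- **The I♯ clause at `(G, r, a)` WITHOUT ENVELOPE (PROVED):** WINDOW(ℓ) + compact-witness floors at `a` + format-at-scale `ℓ` ⇒ for every
budget `δ`, eventually a mesh `b` with `a β · b < T` carrying `TypShellCondUKPc` (`SharpLanes.onsetSharpAt_iff_typFormatAtScaleAt_inv`).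
[kernel composition; hypotheses OPEN] -/
theorem onsetSharp_clause_of_laneA_cpt (r : LatticeRep G) (a ℓ : ℝ → ℝ) (ha : ∀ β, 0 < a β)
    (haf : CovWindowAt G r ℓ) (hlbc : LowerBoundsCpt G r a) {n : ℕ} {ε : ℝ}
    (hF : TypFormatAtScaleAt r.ρ n ε ℓ) :
    ∀ δ : ℝ, 0 < δ → ∃ T β₂ : ℝ, ∀ β : ℝ, β₂ ≤ β →
      ∃ b : ℕ, 1 ≤ b ∧ a β * (b : ℝ) < T ∧ TypShellCondUKPc r.ρ β b n ε δ :=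
  (onsetSharpAt_iff_typFormatAtScaleAt_inv r.ρ a ha n ε).mpr
    (typFormatAtScaleAt_inv_of_covWindow_cpt r a ℓ ha haf hlbc hF)

/-- **`GapInUnits G r a` WITHOUT ENVELOPE at a general scale (PROVED):** WINDOW(ℓ) + compact-witness floors at `a` + the format at ONE budget
`δ₀` at scale `ℓ` + its clustering contract at rate `κ > 0` (generation 2's `gapInUnits_of_window_format_clustering_of_compactWitness`).
[kernel composition; hypotheses OPEN] -/
theorem gapInUnits_of_covWindow_cpt (r : LatticeRep G) (a ℓ : ℝ → ℝ) (ha : ∀ β, 0 < a β)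
    (haf : CovWindowAt G r ℓ) (hlbc : LowerBoundsCpt G r a) {n : ℕ} {ε δ₀ κ : ℝ} {s₀ : ℕ} (hκ : 0 < κ)
    (hcl : FmtClustering r (fun β b => TypShellCondUKPc r.ρ β b n ε δ₀) κ s₀)
    (hF : ∃ B β₂ : ℝ, 0 < B ∧ ∀ β : ℝ, β₂ ≤ β → ∃ b : ℕ, 1 ≤ b ∧ (b : ℝ) ≤ B * ℓ β ∧ TypShellCondUKPc r.ρ β b n ε δ₀) :
    GapInUnits G r a :=
  gapInUnits_of_window_format_clustering_of_compactWitness r a ℓ ha hκ hcl hF haf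
    (compactWitness_of_lowerBoundsCpt hlbc)

end Pointwise

/-- **Lane (1)A without envelope ⇒ I♯_SC-cpt (PROVED composition).**  The compact-witness twin of
`SharpLanes.onsetSharpUKPcSC_of_laneAContractSC`, with `CovEnvelopeAt` gone from the hypotheses. [hypotheses OPEN] -/
theorem onsetSharpUKPcSCCpt_of_laneAWindowContractSC (h : LaneAWindowContractSC) : OnsetSharpUKPcSCCpt := by
  intro G _ _ _ _ hG hsc
  letI : MeasurableSpace G := borel G
  haveI : BorelSpace G := ⟨rfl⟩
  intro r a ha _ hlbc
  obtain ⟨n, ε, hn, hε, hM, ℓ, hF, haf⟩ := h G hG hsc r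
  exact ⟨n, ε, hn, hε, hM, onsetSharp_clause_of_laneA_cpt r a ℓ ha haf hlbc hF⟩

/-- **Lane (1)A without envelope ∧ residual-cpt ⇒ `IRCpt` (PROVED composition; E discharged by p524017, no X-stub, NO ENVELOPE).** -/
theorem irCpt_of_laneAWindowContractSC (h : LaneAWindowContractSC) (hN : IRNSCCpt) : IRCpt :=
  irCpt_of_onsetSharpSCCpt (onsetSharpUKPcSCCpt_of_laneAWindowContractSC h) hN

/-- With the REGISTERED residual `SharpOnset.IRNSC` (stronger than its compact twin): lane (1)A without envelope ⇒ `IRCpt`. -/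
theorem irCpt_of_laneAWindowContractSC_of_irNSC (h : LaneAWindowContractSC) (hN : SharpOnset.IRNSC) : IRCpt :=
  irCpt_of_laneAWindowContractSC h (irNSCCpt_of_irNSC hN)

/-! ### The femto instances (generation 3's packages, envelope dropped) -/

/-- **Lane (1)A contract, femto form WITHOUT ENVELOPE (SC family):** per simply connected `(G, r)`, admissible `(n, ε)`, a positive unit map `u`,
the format at scale `1/u` and the TEMPERED femto conditional AF package in unit `u` (`Femto.TemperedFemtoAFAt`; the exterior-uniform package
`Femto.FemtoAFAt` implies it, `Femto.temperedFemtoAFAt_of_femtoAFAt`).  = generation 3's `Femto.LaneATemperedContractSC` minus `CovEnvelopeAt`. -/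
def LaneAFemtoWindowContractSC : Prop :=
  ∀ (G : Type) [Group G] [TopologicalSpace G] [IsTopologicalGroup G] [CompactSpace G],
    IsCompactSimpleLieGroup G → SimplyConnectedSpace G →
    letI : MeasurableSpace G := borel G; haveI : BorelSpace G := ⟨rfl⟩;
    ∀ r : LatticeRep G, ∃ (n : ℕ) (ε : ℝ), 1 ≤ n ∧ 0 ≤ ε ∧ ε * OnsetFormats.shellCount n ≤ 3 / 4 ∧
      ∃ u : ℝ → ℝ, (∀ β, 0 < u β) ∧ TypFormatAtScaleAt r.ρ n ε (fun β => 1 / u β) ∧ Femto.TemperedFemtoAFAt G r u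

/-- Generation 3's tempered contract (with envelope) implies the envelope-free femto contract. [bookkeeping] -/
theorem laneAFemtoWindowContractSC_of_tempered (h : Femto.LaneATemperedContractSC) : LaneAFemtoWindowContractSC := by
  intro G _ _ _ _ hG hsc
  letI : MeasurableSpace G := borel G
  haveI : BorelSpace G := ⟨rfl⟩
  intro r
  obtain ⟨n, ε, hn, hε, hM, u, hu, hF, -, hfem⟩ := h G hG hsc r
  exact ⟨n, ε, hn, hε, hM, u, hu, hF, hfem⟩

/-- Generation 3's exterior-uniform femto contract (with envelope) implies the envelope-free femto contract. [bookkeeping] -/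
theorem laneAFemtoWindowContractSC_of_femto (h : Femto.LaneAFemtoContractSC) : LaneAFemtoWindowContractSC :=
  laneAFemtoWindowContractSC_of_tempered (Femto.laneATemperedContractSC_of_femto h)

/-- **The envelope-free femto contract implies the envelope-free lane (1)A contract** (`Femto.covWindowAt_of_temperedFemtoAFAt` at `ℓ = 1/u`).
[kernel reduction; hypotheses OPEN] -/
theorem laneAWindowContractSC_of_femtoWindow (h : LaneAFemtoWindowContractSC) : LaneAWindowContractSC := by
  intro G _ _ _ _ hG hsc
  letI : MeasurableSpace G := borel G
  haveI : BorelSpace G := ⟨rfl⟩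
  intro r
  obtain ⟨n, ε, hn, hε, hM, u, hu, hF, hfem⟩ := h G hG hsc r
  exact ⟨n, ε, hn, hε, hM, fun β => 1 / u β, hF, Femto.covWindowAt_of_temperedFemtoAFAt r hu hfem⟩

/-- **Femto contract without envelope ⇒ I♯_SC-cpt (PROVED composition).** -/
theorem onsetSharpUKPcSCCpt_of_femtoWindow (h : LaneAFemtoWindowContractSC) : OnsetSharpUKPcSCCpt :=
  onsetSharpUKPcSCCpt_of_laneAWindowContractSC (laneAWindowContractSC_of_femtoWindow h)

/-- **Femto contract without envelope ∧ registered residual ⇒ `IRCpt` (PROVED composition; no envelope anywhere).** -/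
theorem irCpt_of_femtoWindow_of_irNSC (h : LaneAFemtoWindowContractSC) (hN : SharpOnset.IRNSC) : IRCpt :=
  irCpt_of_laneAWindowContractSC_of_irNSC (laneAWindowContractSC_of_femtoWindow h) hN

end Summit.QuantumFields.YangMills.Cruxes.IR.AfPincerUc.Compact

end
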